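import Summits.NavierStokesRegularity.TurbBounds.ShearSpecEntriesTF
import HarnessLib

/-!
# Forms of the TWO-FIELD (plane Couette) tables on real coefficient vectors (rbsdp SPEC §3.5–3.7 as identities of forms)

Cell `turb-bounds` (pub-turb), shear lane, pub-turb-shear gen 6 (2026-08-22); v2 lane. With `a = D1 c`, `b = D0 c` (from the `W_xx` coefficients `c`) and
`e = DT d` (from the `Θ_x` coefficients `d`) as row functionals `lin`:
* `qform_xwTab` : `cᵀ XW c = 16·KINV2·Σ_{j<LW} w_j c_j² + 8·Σ_{n<LW−1} w_n a_n² + K2·Σ_{n<LW−2} w_n b_n²` (SPEC 3.5, W part);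
* `qform_xtTab` : `dᵀ XT d = 4·Σ_{j<LT} w_j d_j² + K2·Σ_{n<LT−1} w_n e_n²` (Θ part);
* `bform_tfETab`: `cᵀ E_p d = Σ_{n,m'<N+P+1} K_p[n][m']·b_n(c)·e_{m'}(d)` (coupling finite part on `S`);
* `qform_gt0Tab`, `qform_gw0Tab`, `qform_hwTab` (the exact tail parts `GT0`, `GW0`, `HW` of SPEC 3.6).
PURE FINSET ALGEBRA. HONEST FRAMING: rigorous bounds for the stated PDE and boundary conditions; no claim about physical turbulence beyond the bound.
-/

set_option linter.style.longLine false

namespace Summit.NavierStokesRegularity.TurbBounds.ShearSpecPiecesTF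

open Finset Summit.NavierStokesRegularity.TurbBounds.ShearSpecPieces

/-- A diagonal seed `diag((range L).map f)` contributes `Σ_{i<L} f(i) x_i²`-type terms: its entry cast. -/
theorem diag_range_entry (L : ℕ) (f : ℕ → ℚ) (i j : ℕ) (hi : i < L) :
    ((if i = j then ((List.range L).map f).getD i 0 else 0 : ℚ) : ℝ) = if i = j then (f i : ℝ) else 0 := by
  rw [getD_map_range, if_pos hi]; split_ifs <;> simp

/-- **`cᵀ XW c`** (SPEC 3.5, W part). -/
theorem qform_xwTab (N P : ℕ) (KINV2 K2 : ℚ) (x : ℕ → ℝ) :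
    qform (xwTab N P KINV2 K2) (N + P + 3) x
      = 16 * (KINV2 : ℝ) * ∑ j ∈ range (N + P + 3), (norm2 j : ℝ) * x j ^ 2
        + 8 * ∑ n ∈ range (N + P + 2), (norm2 n : ℝ) * lin (tfD1 N P) (N + P + 3) n x ^ 2
        + (K2 : ℝ) * ∑ n ∈ range (N + P + 1), (norm2 n : ℝ) * lin (tfD0 N P) (N + P + 3) n x ^ 2 := by
  unfold qform bform
  have hentry : ∀ i ∈ range (N + P + 3), ∀ j ∈ range (N + P + 3),
      x i * (get2 (xwTab N P KINV2 K2) i j : ℝ) * x j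
        = x i * (if i = j then 16 * (KINV2 : ℝ) * norm2 i else 0) * x j
          + x i * (∑ n ∈ range (N + P + 2), (8 * (norm2 n : ℝ)) * get2 (tfD1 N P) n i * get2 (tfD1 N P) n j) * x j
          + x i * (∑ n ∈ range (N + P + 1), ((K2 : ℝ) * norm2 n) * get2 (tfD0 N P) n i * get2 (tfD0 N P) n j) * x j := by
    intro i hi j _
    have hi' : i < N + P + 3 := by simpa using hi
    rw [get2_xwTab]
    push_cast
    rw [diag_range_entry _ _ _ _ hi']
    push_cast
    ring
  rw [Finset.sum_congr rfl fun i hi => Finset.sum_congr rfl fun j hj => hentry i hi j hj]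
  simp only [Finset.sum_add_distrib]
  rw [sum_sum_diag, sum_sum_gram, sum_sum_gram]
  simp only [lin_eq]
  have e1 : ∑ i ∈ range (N + P + 3), 16 * (KINV2 : ℝ) * (norm2 i : ℝ) * x i * x i = 16 * (KINV2 : ℝ) * ∑ j ∈ range (N + P + 3), (norm2 j : ℝ) * x j ^ 2 := by
    rw [Finset.mul_sum]; exact Finset.sum_congr rfl fun i _ => by ring
  have e2 : ∑ n ∈ range (N + P + 2), 8 * (norm2 n : ℝ) * (∑ i ∈ range (N + P + 3), (get2 (tfD1 N P) n i : ℝ) * x i)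
        * (∑ j ∈ range (N + P + 3), (get2 (tfD1 N P) n j : ℝ) * x j)
      = 8 * ∑ n ∈ range (N + P + 2), (norm2 n : ℝ) * (∑ j ∈ range (N + P + 3), (get2 (tfD1 N P) n j : ℝ) * x j) ^ 2 := by
    rw [Finset.mul_sum]; exact Finset.sum_congr rfl fun n _ => by ring
  have e3 : ∑ n ∈ range (N + P + 1), (K2 : ℝ) * (norm2 n : ℝ) * (∑ i ∈ range (N + P + 3), (get2 (tfD0 N P) n i : ℝ) * x i)
        * (∑ j ∈ range (N + P + 3), (get2 (tfD0 N P) n j : ℝ) * x j)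
      = (K2 : ℝ) * ∑ n ∈ range (N + P + 1), (norm2 n : ℝ) * (∑ j ∈ range (N + P + 3), (get2 (tfD0 N P) n j : ℝ) * x j) ^ 2 := by
    rw [Finset.mul_sum]; exact Finset.sum_congr rfl fun n _ => by ring
  rw [e1, e2, e3]

/-- **`dᵀ XT d`** (SPEC 3.5, Θ part). -/
theorem qform_xtTab (N P : ℕ) (K2 : ℚ) (y : ℕ → ℝ) :
    qform (xtTab N P K2) (N + P + 2) y
      = 4 * ∑ j ∈ range (N + P + 2), (norm2 j : ℝ) * y j ^ 2
        + (K2 : ℝ) * ∑ n ∈ range (N + P + 1), (norm2 n : ℝ) * lin (tfDT N P) (N + P + 2) n y ^ 2 := by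
  unfold qform bform
  have hentry : ∀ i ∈ range (N + P + 2), ∀ j ∈ range (N + P + 2),
      y i * (get2 (xtTab N P K2) i j : ℝ) * y j
        = y i * (if i = j then 4 * (norm2 i : ℝ) else 0) * y j
          + y i * (∑ n ∈ range (N + P + 1), ((K2 : ℝ) * norm2 n) * get2 (tfDT N P) n i * get2 (tfDT N P) n j) * y j := by
    intro i hi j _
    have hi' : i < N + P + 2 := by simpa using hi
    rw [get2_xtTab]
    push_cast
    rw [diag_range_entry _ _ _ _ hi']
    push_cast
    ring
  rw [Finset.sum_congr rfl fun i hi => Finset.sum_congr rfl fun j hj => hentry i hi j hj]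
  simp only [Finset.sum_add_distrib]
  rw [sum_sum_diag, sum_sum_gram]
  simp only [lin_eq]
  have e1 : ∑ i ∈ range (N + P + 2), 4 * (norm2 i : ℝ) * y i * y i = 4 * ∑ j ∈ range (N + P + 2), (norm2 j : ℝ) * y j ^ 2 := by
    rw [Finset.mul_sum]; exact Finset.sum_congr rfl fun i _ => by ring
  have e3 : ∑ n ∈ range (N + P + 1), (K2 : ℝ) * (norm2 n : ℝ) * (∑ i ∈ range (N + P + 2), (get2 (tfDT N P) n i : ℝ) * y i)
        * (∑ j ∈ range (N + P + 2), (get2 (tfDT N P) n j : ℝ) * y j)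
      = (K2 : ℝ) * ∑ n ∈ range (N + P + 1), (norm2 n : ℝ) * (∑ j ∈ range (N + P + 2), (get2 (tfDT N P) n j : ℝ) * y j) ^ 2 := by
    rw [Finset.mul_sum]; exact Finset.sum_congr rfl fun n _ => by ring
  rw [e1, e3]

/-- A rectangular bilinear form `Σ_{i<LW} Σ_{j<LT} x_i M_ij y_j`. -/
def rform (M : List (List ℚ)) (LW LT : ℕ) (x y : ℕ → ℝ) : ℝ := ∑ i ∈ range LW, ∑ j ∈ range LT, x i * (get2 M i j : ℝ) * y j

/-- A Gram-type rectangular form. -/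
theorem sum_sum_gram_rect (a : ℕ → ℝ) (d e : ℕ → ℕ → ℝ) (x y : ℕ → ℝ) (m LW LT : ℕ) :
    ∑ i ∈ range LW, ∑ j ∈ range LT, x i * (∑ n ∈ range m, a n * d n i * e n j) * y j
      = ∑ n ∈ range m, a n * (∑ i ∈ range LW, d n i * x i) * (∑ j ∈ range LT, e n j * y j) := by
  have h1 : ∑ i ∈ range LW, ∑ j ∈ range LT, x i * (∑ n ∈ range m, a n * d n i * e n j) * y j
      = ∑ i ∈ range LW, ∑ j ∈ range LT, ∑ n ∈ range m, x i * (a n * d n i * e n j) * y j :=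
    Finset.sum_congr rfl fun i _ => Finset.sum_congr rfl fun j _ => by rw [Finset.mul_sum, Finset.sum_mul]
  have h2 : ∑ i ∈ range LW, ∑ j ∈ range LT, ∑ n ∈ range m, x i * (a n * d n i * e n j) * y j
      = ∑ n ∈ range m, ∑ i ∈ range LW, ∑ j ∈ range LT, x i * (a n * d n i * e n j) * y j := by
    rw [Finset.sum_congr rfl fun i _ => Finset.sum_comm, Finset.sum_comm]
  rw [h1, h2]
  refine Finset.sum_congr rfl fun n _ => ?_
  rw [show a n * (∑ i ∈ range LW, d n i * x i) * (∑ j ∈ range LT, e n j * y j)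
      = a n * ((∑ i ∈ range LW, d n i * x i) * (∑ j ∈ range LT, e n j * y j)) by ring, Finset.sum_mul_sum]
  simp only [Finset.mul_sum]
  exact Finset.sum_congr rfl fun i _ => Finset.sum_congr rfl fun j _ => by ring

/-- **`cᵀ E_p d = Σ_{n,m'<N+P+1} K_p[n][m']·b_n(c)·e_{m'}(d)`** (SPEC 3.5 coupling, finite part; `b = D0 c`, `e = DT d`). -/
theorem bform_tfETab (N P p : ℕ) (x y : ℕ → ℝ) :
    rform (tfETab N P p) (N + P + 3) (N + P + 2) x y
      = ∑ n ∈ range (N + P + 1), ∑ m' ∈ range (N + P + 1),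
          (get2 (tfKTab N P p) n m' : ℝ) * lin (tfD0 N P) (N + P + 3) n x * lin (tfDT N P) (N + P + 2) m' y := by
  unfold rform
  have hentry : ∀ i j, x i * (get2 (tfETab N P p) i j : ℝ) * y j
      = ∑ n ∈ range (N + P + 1), x i * (∑ m' ∈ range (N + P + 1),
          (get2 (tfKTab N P p) n m' : ℝ) * get2 (tfD0 N P) n i * get2 (tfDT N P) m' j) * y j := by
    intro i j
    rw [get2_tfETab]
    push_cast
    rw [Finset.mul_sum, Finset.sum_mul]
    refine Finset.sum_congr rfl fun n _ => ?_
    have e : ∑ m' ∈ range (N + P + 1), (get2 (tfKTab N P p) n m' : ℝ) * get2 (tfD0 N P) n i * get2 (tfDT N P) m' j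
        = (get2 (tfD0 N P) n i : ℝ) * ∑ m' ∈ range (N + P + 1), (get2 (tfKTab N P p) n m' : ℝ) * get2 (tfDT N P) m' j := by
      rw [Finset.mul_sum]; exact Finset.sum_congr rfl fun m' _ => by ring
    rw [e]
  rw [Finset.sum_congr rfl fun i _ => Finset.sum_congr rfl fun j _ => hentry i j]
  rw [Finset.sum_congr rfl fun i _ => Finset.sum_comm, Finset.sum_comm]
  refine Finset.sum_congr rfl fun n _ => ?_
  rw [sum_sum_gram_rect]
  rfl

/-- **`dᵀ GT0 d = Σ_{n=N+1}^{LT−2} w_n e_n²`** (exact part of the Θ tail). -/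
theorem qform_gt0Tab (N P : ℕ) (y : ℕ → ℝ) :
    qform (gt0Tab N P) (N + P + 2) y
      = ∑ n ∈ range (N + P + 1), (if N + 1 ≤ n then (norm2 n : ℝ) else 0) * lin (tfDT N P) (N + P + 2) n y ^ 2 := by
  unfold qform bform
  have hentry : ∀ i j, y i * (get2 (gt0Tab N P) i j : ℝ) * y j
      = y i * (∑ n ∈ range (N + P + 1), (if N + 1 ≤ n then (norm2 n : ℝ) else 0) * get2 (tfDT N P) n i * get2 (tfDT N P) n j) * y j := by
    intro i j; rw [get2_gt0Tab]; push_cast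
    congr 1; congr 1; exact Finset.sum_congr rfl fun n _ => by split_ifs <;> simp
  simp_rw [hentry]
  rw [sum_sum_gram]
  simp only [lin_eq]
  exact Finset.sum_congr rfl fun n _ => by ring

/-- **`cᵀ GW0 c = Σ_{n=N+1}^{LW−3} w_n b_n²`** (exact part of the W tail). -/
theorem qform_gw0Tab (N P : ℕ) (x : ℕ → ℝ) :
    qform (gw0Tab N P) (N + P + 3) x
      = ∑ n ∈ range (N + P + 1), (if N + 1 ≤ n then (norm2 n : ℝ) else 0) * lin (tfD0 N P) (N + P + 3) n x ^ 2 := by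
  unfold qform bform
  have hentry : ∀ i j, x i * (get2 (gw0Tab N P) i j : ℝ) * x j
      = x i * (∑ n ∈ range (N + P + 1), (if N + 1 ≤ n then (norm2 n : ℝ) else 0) * get2 (tfD0 N P) n i * get2 (tfD0 N P) n j) * x j := by
    intro i j; rw [get2_gw0Tab]; push_cast
    congr 1; congr 1; exact Finset.sum_congr rfl fun n _ => by split_ifs <;> simp
  simp_rw [hentry]
  rw [sum_sum_gram]
  simp only [lin_eq]
  exact Finset.sum_congr rfl fun n _ => by ring

/-- **`cᵀ HW c = Σ_{j<LW−1} ω_{LW−2}(j)·a_j² + μ_W·Σ_{j<LW} ω_{LW−1}(j)·c_j²`** (SPEC 3.6). -/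
theorem qform_hwTab (N P : ℕ) (x : ℕ → ℝ) :
    qform (hwTab N P) (N + P + 3) x
      = (tfMuW N P : ℝ) * ∑ j ∈ range (N + P + 3), (omega (N + P + 2) j : ℝ) * x j ^ 2
        + ∑ n ∈ range (N + P + 2), (omega (N + P + 1) n : ℝ) * lin (tfD1 N P) (N + P + 3) n x ^ 2 := by
  unfold qform bform
  have hentry : ∀ i ∈ range (N + P + 3), ∀ j ∈ range (N + P + 3),
      x i * (get2 (hwTab N P) i j : ℝ) * x j
        = x i * (if i = j then (tfMuW N P : ℝ) * omega (N + P + 2) i else 0) * x j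
          + x i * (∑ n ∈ range (N + P + 2), (omega (N + P + 1) n : ℝ) * get2 (tfD1 N P) n i * get2 (tfD1 N P) n j) * x j := by
    intro i hi j _
    have hi' : i < N + P + 3 := by simpa using hi
    rw [get2_hwTab]
    push_cast
    rw [diag_range_entry _ _ _ _ hi']
    push_cast
    ring
  rw [Finset.sum_congr rfl fun i hi => Finset.sum_congr rfl fun j hj => hentry i hi j hj]
  simp only [Finset.sum_add_distrib]
  rw [sum_sum_diag, sum_sum_gram]
  simp only [lin_eq]
  have e1 : ∑ i ∈ range (N + P + 3), (tfMuW N P : ℝ) * (omega (N + P + 2) i : ℝ) * x i * x i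
      = (tfMuW N P : ℝ) * ∑ j ∈ range (N + P + 3), (omega (N + P + 2) j : ℝ) * x j ^ 2 := by
    rw [Finset.mul_sum]; exact Finset.sum_congr rfl fun i _ => by ring
  rw [e1]
  congr 1
  exact Finset.sum_congr rfl fun n _ => by ring

end Summit.NavierStokesRegularity.TurbBounds.ShearSpecPiecesTF
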